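import Summits.Ventures.PackingBounds.ThreePointCert.CheckKS

/-!
# Kronecker-substitution validation of the three-point part `FI`

Framing: lottery ticket; floor = certified bounds/negative ranges. Venture `PackingBounds`
(cell `pub-packcert`), three-point SDP family — kernel-checking infrastructure.

The claimed expansion `FP` of the three-point part `FI = Σ_blocks M_k Σ_w sym6(φ_w(u) φ_w(v) QI_k)`
of a certificate is validated WITHOUT expanding `FPolyG` term by term (`CheckFastFZ.FchunkOKZ`:
Gram forms over the `symTabG` tables, sorted merges, 4–13 kernel files per row): the kernel
compares the value of `FP` at the Kronecker point `(2^w, 2^{wD}, 2^{wD²})`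
(`ThreePointCert.KroneckerEval`) with the integer `Σ_b M_k Σ_w Σ_π φ_w(π₁) φ_w(π₂) QI_k(π)` over the
six coordinate permutations `π` — a few thousand big-integer products (`fCheckKS`). The comparison
polynomial is a "ghost": `gF` (built from `mul`, `smul`, `++` and the permutations only, so that its
value, integer value, exponents and absolute coefficient sum are available by structural induction)
has the same values as `FPolyG` (`eval_gF`); it is never evaluated by the kernel. This file:
ghost, kernel programs, real and integer values; bounds and the soundness theorem
`fexpValidG_of_fCheckKS` are in `ThreePointCert.CheckFKSSound`. No statement about certificates
changes.
-/

noncomputable section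

namespace Summit.Ventures.PackingBounds.ThreePointCert

open Literature.Geometry.DiscreteGeometry Literature.Geometry.DiscreteGeometry.PolyCert
open Literature.Geometry.DiscreteGeometry.PolyCert.SPoly

/-! ### The ghost polynomial -/

/-- `QI n k` by the same three-term recurrence, without normalisation (same values: `eval_qiRaw`). -/
def qiRaw (n : ℕ) : ℕ → SPoly
  | 0 => C 1
  | 1 => smul ((n : ℤ) - 3) sigP
  | j + 2 => smul (2 * (j : ℤ) + n - 1) (mul sigP (qiRaw n (j + 1))) ++
      smul (-(4 * ((j : ℤ) + 1) * ((j : ℤ) + n - 3))) (mul piP (qiRaw n j))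

/-- `Σ_i w_i u^{a+i}` as a term list. -/
def phiUA : List ℤ → ℕ → SPoly
  | [], _ => []
  | c :: cs, a => (⟨a, 0, 0⟩, c) :: phiUA cs (a + 1)

/-- `Σ_i w_i v^{a+i}` as a term list. -/
def phiVA : List ℤ → ℕ → SPoly
  | [], _ => []
  | c :: cs, a => (⟨0, a, 0⟩, c) :: phiVA cs (a + 1)

/-- The six coordinate permutations of a term list, concatenated. -/
def sym6P (p : SPoly) : SPoly := p ++ permBAC p ++ permACB p ++ permCBA p ++ permCAB p ++ permBCA p

/-- One weight vector: `sym6 (φ_w(u) φ_w(v) QI_k)`. -/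
def gW (n k : ℕ) (w : List ℤ) : SPoly := sym6P (mul (mul (phiUA w 0) (phiVA w 0)) (qiRaw n k))

/-- The weight vectors of one block. -/
def gWs (n k : ℕ) : List (List ℤ) → SPoly
  | [] => []
  | w :: ws => gW n k w ++ gWs n k ws

/-- The ghost of `FPolyG`: `Σ_blocks M_k • Σ_w gW`. -/
def gF (n d : ℕ) : List FBlk → SPoly
  | [] => []
  | b :: bs => smul (Mfac d b.k : ℤ) (gWs n b.k b.ws) ++ gF n d bs

/-! ### Kernel programs -/

/-- `Σ_i c_i · pw · x^i` (the value of `phiUA`/`phiVA` at an integer point, `pw = x^a`). -/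
def phiZA (x : ℤ) : List ℤ → ℤ → ℤ
  | [], _ => 0
  | c :: cs, pw => c * pw + phiZA x cs (pw * x)

/-- `QI n k` at an integer point by the recurrence. -/
def qiZ (n : ℕ) (x y z : ℤ) : ℕ → ℤ
  | 0 => 1
  | 1 => ((n : ℤ) - 3) * (2 * (z - x * y))
  | j + 2 => (2 * (j : ℤ) + n - 1) * (2 * (z - x * y)) * qiZ n x y z (j + 1) +
      -(4 * ((j : ℤ) + 1) * ((j : ℤ) + n - 3)) * ((1 - x * x) * (1 - y * y)) * qiZ n x y z j

/-- One weight vector at an integer point: the six permuted products `φ_w(π₁) φ_w(π₂) QI_k(π)`,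
with the six `QI_k` values `q = (q_e, q_bac, q_acb, q_cba, q_cab, q_bca)` precomputed. -/
def gWZ (w : List ℤ) (x y z : ℤ) (q : ℤ × ℤ × ℤ × ℤ × ℤ × ℤ) : ℤ :=
  phiZA x w 1 * phiZA y w 1 * q.1 + phiZA y w 1 * phiZA x w 1 * q.2.1 +
    phiZA x w 1 * phiZA z w 1 * q.2.2.1 + phiZA z w 1 * phiZA y w 1 * q.2.2.2.1 +
    phiZA y w 1 * phiZA z w 1 * q.2.2.2.2.1 + phiZA z w 1 * phiZA x w 1 * q.2.2.2.2.2

/-- The weight vectors of one block at an integer point. -/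
def gWsZ (x y z : ℤ) (q : ℤ × ℤ × ℤ × ℤ × ℤ × ℤ) : List (List ℤ) → ℤ
  | [] => 0
  | w :: ws => gWZ w x y z q + gWsZ x y z q ws

/-- The six `QI_k` values at the permuted points. -/
def qiSix (n k : ℕ) (x y z : ℤ) : ℤ × ℤ × ℤ × ℤ × ℤ × ℤ :=
  (qiZ n x y z k, qiZ n y x z k, qiZ n x z y k, qiZ n z y x k, qiZ n y z x k, qiZ n z x y k)

/-- The ghost `gF` at an integer point. -/
def gFZ (n d : ℕ) (x y z : ℤ) : List FBlk → ℤ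
  | [] => 0
  | b :: bs => (Mfac d b.k : ℤ) * gWsZ x y z (qiSix n b.k x y z) b.ws + gFZ n d x y z bs

/-- `absSum (qiRaw n k)` by the recurrence. -/
def qiAbs (n : ℕ) : ℕ → ℕ
  | 0 => 1
  | 1 => ((n : ℤ) - 3).natAbs * 4
  | j + 2 => (2 * (j : ℤ) + n - 1).natAbs * (4 * qiAbs n (j + 1)) +
      (4 * ((j : ℤ) + 1) * ((j : ℤ) + n - 3)).natAbs * (4 * qiAbs n j)

/-- `Σ_i |w_i|`. -/
def absList (w : List ℤ) : ℕ := (w.map Int.natAbs).sum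

/-- `absSum` of the weight vectors of one block. -/
def gWsAbs (n k : ℕ) : List (List ℤ) → ℕ
  | [] => 0
  | w :: ws => 6 * (absList w * absList w * qiAbs n k) + gWsAbs n k ws

/-- `absSum (gF n d bs)`. -/
def gFAbs (n d : ℕ) : List FBlk → ℕ
  | [] => 0
  | b :: bs => Mfac d b.k * gWsAbs n b.k b.ws + gFAbs n d bs

/-- **The Kronecker-substitution check of the three-point part**: exponent side conditions, the
coefficient bound, and `FP = gF` at the point `(2^w, 2^{wD}, 2^{wD²})`. -/
def fCheckKS (w D n d : ℕ) (bs : List FBlk) (FP : SPoly) : Bool :=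
  (bs.all fun b => b.ws.all fun w' => decide (w'.length + b.k ≤ D)) && boxOK D FP &&
    decide (2 * (absSum FP + gFAbs n d bs) < 2 ^ w) &&
    decide (Int.subNatNat (encP w D FP) (encN w D FP) =
      gFZ n d (2 ^ w) (2 ^ (w * D)) (2 ^ (w * D * D)) bs)

/-! ### Values of the ghost -/

/-- `qiRaw` has the values of `QI`. -/
theorem eval_qiRaw (n : ℕ) (u v t : ℝ) : ∀ k, eval (qiRaw n k) u v t = eval (QI n k) u v t
  | 0 => rfl
  | 1 => rfl
  | j + 2 => by
    rw [qiRaw, QI, eval_normalize, eval_append, eval_append, eval_smul, eval_smul, eval_smul,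
      eval_smul, eval_mul, eval_mul, eval_mulN, eval_mulN, eval_qiRaw n u v t (j + 1),
      eval_qiRaw n u v t j]

/-- `phiUA w a` has the value `Σ_{i<|w|} w_i u^{a+i}`. -/
theorem eval_phiUA (u v t : ℝ) : ∀ (w : List ℤ) (a : ℕ),
    eval (phiUA w a) u v t = ∑ i ∈ Finset.range w.length, (w.getD i 0 : ℝ) * u ^ (a + i)
  | [], a => by simp [phiUA]
  | c :: cs, a => by
    rw [phiUA, eval_cons, eval_phiUA u v t cs (a + 1), List.length_cons, Finset.sum_range_succ']
    simp only [Mono.eval, pow_zero, mul_one, List.getD_cons_succ, List.getD_cons_zero, add_zero]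
    rw [add_comm]
    congr 1
    exact Finset.sum_congr rfl fun i _ => by rw [show a + 1 + i = a + (i + 1) by ring]

/-- `phiVA w a` has the value `Σ_{i<|w|} w_i v^{a+i}`. -/
theorem eval_phiVA (u v t : ℝ) : ∀ (w : List ℤ) (a : ℕ),
    eval (phiVA w a) u v t = ∑ i ∈ Finset.range w.length, (w.getD i 0 : ℝ) * v ^ (a + i)
  | [], a => by simp [phiVA]
  | c :: cs, a => by
    rw [phiVA, eval_cons, eval_phiVA u v t cs (a + 1), List.length_cons, Finset.sum_range_succ']
    simp only [Mono.eval, pow_zero, mul_one, one_mul, List.getD_cons_succ, List.getD_cons_zero,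
      add_zero]
    rw [add_comm]
    congr 1
    exact Finset.sum_congr rfl fun i _ => by rw [show a + 1 + i = a + (i + 1) by ring]

/-- `phiUA w 0 = φ_w(u)`. -/
theorem eval_phiUA_zero (w : List ℤ) (u v t : ℝ) : eval (phiUA w 0) u v t = phiW w u := by
  rw [eval_phiUA, phiW]; simp

/-- `phiVA w 0 = φ_w(v)`. -/
theorem eval_phiVA_zero (w : List ℤ) (u v t : ℝ) : eval (phiVA w 0) u v t = phiW w v := by
  rw [eval_phiVA, phiW]; simp

/-- `eval (sym6P p) = sym6 (eval p)`. -/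
theorem eval_sym6P (p : SPoly) (u v t : ℝ) :
    eval (sym6P p) u v t = sym6 (fun u v t => eval p u v t) u v t := by
  simp only [sym6P, eval_append, eval_permBAC, eval_permACB, eval_permCBA, eval_permCAB,
    eval_permBCA, sym6]

/-- `gW` has the value of `FwPolyG`. -/
theorem eval_gW (n k : ℕ) (w : List ℤ) (u v t : ℝ) :
    eval (gW n k w) u v t = eval (FwPolyG n k w) u v t := by
  rw [eval_FwPolyG, gW, eval_sym6P]
  have key : ∀ x y r : ℝ, eval (mul (mul (phiUA w 0) (phiVA w 0)) (qiRaw n k)) x y r =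
      2 ^ k * (k.factorial : ℝ) * YG n k (phiW w) x y r := by
    intro x y r
    rw [eval_mul, eval_mul, eval_phiUA_zero, eval_phiVA_zero, eval_qiRaw, eval_QI, YG]; ring
  simp only [sym6, key]; ring

/-- `gWs` has the value of the block's inner sum. -/
theorem eval_gWs (n k : ℕ) (u v t : ℝ) : ∀ ws : List (List ℤ),
    eval (gWs n k ws) u v t = eval (mergeAll (ws.map (FwPolyG n k))) u v t
  | [] => by simp [gWs, eval_mergeAll]
  | w :: ws => by
    rw [gWs, eval_append, eval_gW, eval_gWs n k u v t ws, eval_mergeAll, eval_mergeAll]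
    simp

/-- **The ghost has the values of `FPolyG`.** -/
theorem eval_gF (n d : ℕ) (u v t : ℝ) : ∀ bs : List FBlk,
    eval (gF n d bs) u v t = eval (FPolyG n d bs) u v t
  | [] => by simp [gF, FPolyG, eval_mergeAll]
  | b :: bs => by
    rw [gF, eval_append, eval_smul, eval_gWs, eval_gF n d u v t bs]
    simp [FPolyG, FbPolyG, eval_mergeAll, List.map_map, Function.comp_def]

/-! ### Integer values of the ghost -/

/-- `evalZ` of the permutations. -/
theorem evalZ_permBAC (p : SPoly) (x y z : ℤ) : evalZ (permBAC p) x y z = evalZ p y x z := by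
  have h : ((evalZ (permBAC p) x y z : ℤ) : ℝ) = ((evalZ p y x z : ℤ) : ℝ) := by
    rw [cast_evalZ, cast_evalZ, eval_permBAC]
  exact_mod_cast h
/-- `evalZ` of `permACB`. -/
theorem evalZ_permACB (p : SPoly) (x y z : ℤ) : evalZ (permACB p) x y z = evalZ p x z y := by
  have h : ((evalZ (permACB p) x y z : ℤ) : ℝ) = ((evalZ p x z y : ℤ) : ℝ) := by
    rw [cast_evalZ, cast_evalZ, eval_permACB]
  exact_mod_cast h
/-- `evalZ` of `permCBA`. -/
theorem evalZ_permCBA (p : SPoly) (x y z : ℤ) : evalZ (permCBA p) x y z = evalZ p z y x := by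
  have h : ((evalZ (permCBA p) x y z : ℤ) : ℝ) = ((evalZ p z y x : ℤ) : ℝ) := by
    rw [cast_evalZ, cast_evalZ, eval_permCBA]
  exact_mod_cast h
/-- `evalZ` of `permCAB`. -/
theorem evalZ_permCAB (p : SPoly) (x y z : ℤ) : evalZ (permCAB p) x y z = evalZ p y z x := by
  have h : ((evalZ (permCAB p) x y z : ℤ) : ℝ) = ((evalZ p y z x : ℤ) : ℝ) := by
    rw [cast_evalZ, cast_evalZ, eval_permCAB]
  exact_mod_cast h
/-- `evalZ` of `permBCA`. -/
theorem evalZ_permBCA (p : SPoly) (x y z : ℤ) : evalZ (permBCA p) x y z = evalZ p z x y := by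
  have h : ((evalZ (permBCA p) x y z : ℤ) : ℝ) = ((evalZ p z x y : ℤ) : ℝ) := by
    rw [cast_evalZ, cast_evalZ, eval_permBCA]
  exact_mod_cast h

/-- `evalZ sigP`. -/
theorem evalZ_sigP (x y z : ℤ) : evalZ sigP x y z = 2 * (z - x * y) := by
  simp [sigP, evalZ, monoEvalZ]; ring
/-- `evalZ piP`. -/
theorem evalZ_piP (x y z : ℤ) : evalZ piP x y z = (1 - x * x) * (1 - y * y) := by
  simp [piP, evalZ, monoEvalZ]; ring
/-- `evalZ (C 1) = 1`. -/
theorem evalZ_C_one (x y z : ℤ) : evalZ (C 1) x y z = 1 := by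
  simp [C, evalZ, monoEvalZ]

/-- `qiZ` is the integer value of `qiRaw`. -/
theorem evalZ_qiRaw (n : ℕ) (x y z : ℤ) : ∀ k, evalZ (qiRaw n k) x y z = qiZ n x y z k
  | 0 => by rw [qiRaw, qiZ, evalZ_C_one]
  | 1 => by rw [qiRaw, qiZ, evalZ_smul, evalZ_sigP]
  | j + 2 => by
    rw [qiRaw, qiZ, evalZ_append, evalZ_smul, evalZ_smul, evalZ_mul, evalZ_mul, evalZ_sigP,
      evalZ_piP, evalZ_qiRaw n x y z (j + 1), evalZ_qiRaw n x y z j]; ring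

/-- `phiZA` is the integer value of `phiUA`. -/
theorem evalZ_phiUA (x y z : ℤ) : ∀ (w : List ℤ) (a : ℕ), evalZ (phiUA w a) x y z = phiZA x w (x ^ a)
  | [], a => by simp [phiUA, phiZA]
  | c :: cs, a => by
    rw [phiUA, evalZ_cons, phiZA, evalZ_phiUA x y z cs (a + 1), pow_succ]
    simp [monoEvalZ]

/-- `phiZA` is the integer value of `phiVA`. -/
theorem evalZ_phiVA (x y z : ℤ) : ∀ (w : List ℤ) (a : ℕ), evalZ (phiVA w a) x y z = phiZA y w (y ^ a)
  | [], a => by simp [phiVA, phiZA]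
  | c :: cs, a => by
    rw [phiVA, evalZ_cons, phiZA, evalZ_phiVA x y z cs (a + 1), pow_succ]
    simp [monoEvalZ]

/-- `gWZ` is the integer value of `gW`. -/
theorem evalZ_gW (n k : ℕ) (w : List ℤ) (x y z : ℤ) :
    evalZ (gW n k w) x y z = gWZ w x y z (qiSix n k x y z) := by
  simp only [gW, sym6P, evalZ_append, evalZ_permBAC, evalZ_permACB, evalZ_permCBA, evalZ_permCAB,
    evalZ_permBCA, evalZ_mul, evalZ_phiUA, evalZ_phiVA, evalZ_qiRaw, pow_zero, gWZ, qiSix]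

/-- `gWsZ` is the integer value of `gWs`. -/
theorem evalZ_gWs (n k : ℕ) (x y z : ℤ) : ∀ ws : List (List ℤ),
    evalZ (gWs n k ws) x y z = gWsZ x y z (qiSix n k x y z) ws
  | [] => by simp [gWs, gWsZ]
  | w :: ws => by rw [gWs, gWsZ, evalZ_append, evalZ_gW, evalZ_gWs n k x y z ws]

/-- `gFZ` is the integer value of the ghost. -/
theorem evalZ_gF (n d : ℕ) (x y z : ℤ) : ∀ bs : List FBlk, evalZ (gF n d bs) x y z = gFZ n d x y z bs
  | [] => by simp [gF, gFZ]
  | b :: bs => by rw [gF, gFZ, evalZ_append, evalZ_smul, evalZ_gWs, evalZ_gF n d x y z bs]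

end Summit.Ventures.PackingBounds.ThreePointCert

end
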